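import Summits.QuantumFields.BalabanUV.T4Continuum.Spine.NE2BalabanFromNE3
import Summits.QuantumFields.BalabanUV.T4Continuum.Support.MinimalActionWitness

/-!
# T⁴ programme, spine node NE2 (U1a), rows B7.w × B6′ — THE JUNCTION WITNESS: node U1b's FULL `NE3Shape` (ACTION half ∧ LOCAL half)
# INHABITED ON NODE NE3's OWN CARRIER by the flat datum, and ROOT B fired THROUGH the c7-adapter END

NE2 formalisation swarm, leaf prover 03 (row B5 lineage; leaf-proposed support item, INTENT CLAIMS.log l.10201).  Three tree facts are joined:
 * the NE3 lineage's non-vacuity witness `Support/MinimalActionWitness.actionRate_flatClass` (t4-ne3-p1, gen 16): for the flat class family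
   `flatClass k = {flatCfg}` and the flat datum, node U1b's ACTION half `ActionRate (minActReadings d flatClass L N {flatCfg} loc)
   (wallConstNA·(g + b³)/L²) (L²)⁻¹` holds for EVERY supplied local reading `loc`;
 * leaf-08-g2's c7 adapter `Spine/NE2BalabanFromNE3` (row B6′): on NE3's carrier `minActReadings … (ne2Loc L M (liftR ∘ Rg))` node U1b's LOCAL half IS
   ROOT B's `hNE3` for every datum (`ne3Shape_minActReadings_iff`, `balaban_final_rate_of_ne3Shape_sq`);
 * leaf-03's `Spine/NE2BalabanFlatWitness` (row B7.w): at `Rg ≡ 1` the local half holds (`localRate_flat`), the (3.35)-class holds with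
   `α = β = 0` (`regularTransporters_flat`), and `0 < η⋆` (`NE2BalabanThreshold.etaStar_pos`, leaf-08).
RESULT: **`ne3Shape_minActReadings_flat`** — `NE3Shape (minActReadings d flatClass L N {flatCfg} (ne2Loc L M fun _ ↦ liftR L M oneR)) 0 (L²)⁻¹`
(`L ≥ 2`, `N ≥ 1`, colour index non-empty): node U1b's FULL hypothesis shape, on NE3's OWN readings object, with the NE2 reading plugged into the
slot NE3 left for consumers, is INHABITED; and **`balaban_final_rate_of_ne3Shape_flat`** — leaf-08-g2's END `balaban_final_rate_of_ne3Shape_sq` fires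
for the flat datum with NO hypothesis left, its conclusion being LITERALLY `NE2BalabanFlatWitness.balaban_final_rate_flat`'s (now reached through
NE3's carrier: the DAG edge NE2(tier B) ⇐ NE3 is exercised end to end by one kernel datum).

HONEST FRAMING (T4-DAG p. 1).  TRIVIAL BY DESIGN (flat datum: zero actions, zero readings) — non-vacuity of the junction, not content; asserts
NOTHING about Bałaban's minimisers `U_k(V)` for non-flat `V` (no B0, c5), nothing about node NE3's estimates (OPEN) or row B5's class for real
data; ROOT B for general data stays CONDITIONAL on node NE3; NOT [B9] (3.23)–(3.26) as printed; NE2 (U1a) is NOT PROVED (c1 with the carver); NE3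
NOT proved; spine PROVED 0/9 unchanged; NOT infinite volume, NOT a mass gap, NOT Clay, NOT summit progress.  HONEST DEPENDENCY: continuum YM on
T⁴ ⇐ BetaPertH ∧ nine spine estimates (0/9 proved); BetaPertH ⇐ (D1) ∧ (D4) ∧ CAP+tail; G-an2-4 gates asym, D1 and NE2/3/4.  ABSOLUTE RULE kept;
no `def … : Prop` fact; no `sorry`.
-/

noncomputable section

open scoped BigOperators ComplexConjugate Matrix Matrix.Norms.L2Operator Kronecker
open Filter Topology

namespace Summit.QuantumFields.BalabanUV.T4Continuum.NE2BalabanFromNE3Flat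

open Literature.MathematicalPhysics.QuantumFieldTheory.Balaban1983to89
open Literature.MathematicalPhysics.QuantumFieldTheory.Balaban1983to89.B5Prop11Plancherel (Cst Tor fine)
open Literature.MathematicalPhysics.QuantumFieldTheory.Balaban1983to89.B5G183RateUnitTower (lev lev_neZero)
open Literature.MathematicalPhysics.QuantumFieldTheory.Balaban1983to89.T4EtaRateMin (Readings LocalRate ActionRate NE3Shape)
open Literature.MathematicalPhysics.QuantumFieldTheory.Balaban1983to89.T4AveragingDeficitNonAbelian (wallConstNA)
open Summit.QuantumFields.BalabanUV.T4Continuum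
open Summit.QuantumFields.BalabanUV.T4Continuum.CovariantAveragingTower (TowerLimitRate)
open Summit.QuantumFields.BalabanUV.T4Continuum.BalabanAveragedTowerUnit (idx Qlev)
open Summit.QuantumFields.BalabanUV.T4Continuum.BackgroundResolventTower
open Summit.QuantumFields.BalabanUV.T4Continuum.KingPairingPlantedLaw
open Summit.QuantumFields.BalabanUV.T4Continuum.GramPerturbationLaw (C2gram)
open Summit.QuantumFields.BalabanUV.T4Continuum.NE2FromNE3 (bgReadings)
open Summit.QuantumFields.BalabanUV.T4Continuum.NE2FromNE3Carrier (ne2Loc)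
open Summit.QuantumFields.BalabanUV.T4Continuum.RegularBackgroundTower (RegularTransporters regClass betaNE3)
open Summit.QuantumFields.BalabanUV.T4Continuum.GaugeTermPerturbationLaw (oneR)
open Summit.QuantumFields.BalabanUV.T4Continuum.GaugeTermScalarData (QuT Q1)
open Summit.QuantumFields.BalabanUV.T4Continuum.RegularSiteTransporters (siteT)
open Summit.QuantumFields.BalabanUV.T4Continuum.NestedContourTransport (theta0)
open Summit.QuantumFields.BalabanUV.T4Continuum.NE2BalabanRoot (balabanPert)
open Summit.QuantumFields.BalabanUV.T4Continuum.NE2BalabanGauge (gaugeSlot liftR)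
open Summit.QuantumFields.BalabanUV.T4Continuum.NE2BalabanLayerSharp (kappaBs C2Bs)
open Summit.QuantumFields.BalabanUV.T4Continuum.NE2BalabanWiring (epsR CdeltaR)
open Summit.QuantumFields.BalabanUV.T4Continuum.NE2BalabanFinal (kappa4F C4F)
open Summit.QuantumFields.BalabanUV.T4Continuum.NE2BalabanThreshold (etaStar etaStar_pos)
open Summit.QuantumFields.BalabanUV.T4Continuum.NE2BalabanFlatWitness (regularTransporters_flat localRate_flat)
open Summit.QuantumFields.BalabanUV.T4Continuum.NE2BalabanFromNE3 (ne3Shape_minActReadings_iff balaban_final_rate_of_ne3Shape_sq)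
open Summit.QuantumFields.BalabanUV.T4Continuum.MinimalActionRate (minActReadings)
open Summit.QuantumFields.BalabanUV.T4Continuum.MinimalActionWitness (flatCfg flatClass actionRate_flatClass)

variable {d : ℕ} (L : ℕ) [NeZero L] (M : Fin d → ℕ) [hM : ∀ μ, NeZero (M μ)] (a : ℝ) (ha : 0 < a)
variable {o : Type*} [Fintype o] [DecidableEq o] [Nonempty o]

omit [NeZero L] hM in
/-- **NODE U1b's FULL SHAPE ON NODE NE3's OWN CARRIER IS INHABITED** (`L ≥ 2`, `N ≥ 1`, non-empty colour index): for the flat class family and the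
flat datum, with the NE2 reading of the flat transporters plugged into NE3's consumer slot, `NE3Shape (minActReadings d flatClass L N {flatCfg}
(ne2Loc L M fun _ ↦ liftR L M oneR)) 0 (L²)⁻¹` — rate honesty `0 ≤ (L²)⁻¹ < 1`, the ACTION half from the NE3 lineage's `actionRate_flatClass` at
`b = g = 0` (constant `wallConstNA·(0 + 0³)/L² = 0`), the LOCAL half from leaf-03's `localRate_flat` through leaf-08-g2's `ne3Shape_minActReadings_iff`.
Trivial by design; NE3 NOT proved. [folklore] -/
theorem ne3Shape_minActReadings_flat (hL : 2 ≤ L) {N : ℕ} (hN : 1 ≤ N) :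
    NE3Shape (minActReadings d flatClass L N {(flatCfg : B7Prop1Explicit.Site d → Fin d → (Matrix o o ℂ)ˣ)}
        (ne2Loc L M fun _ => liftR L M (oneR L M (o := o))))
      0 (((L : ℝ) ^ 2)⁻¹) := by
  have hL1 : 1 ≤ L := le_trans (by norm_num) hL
  have hL2 : (2 : ℝ) ≤ L := by exact_mod_cast hL
  have hLsq : (1 : ℝ) < (L : ℝ) ^ 2 := by nlinarith
  have hθ0 : (0 : ℝ) ≤ ((L : ℝ) ^ 2)⁻¹ := by positivity
  -- the NE3 lineage's ACTION half at `b = g = 0`, constant `wallConstNA·(0 + 0³)/L² = 0`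
  have hA := actionRate_flatClass (d := d) (n := o) hL1 hN (b := 0) (g := 0) le_rfl (by norm_num) le_rfl
    (ne2Loc L M fun _ => liftR L M (oneR L M (o := o)))
  have e0 : wallConstNA d L * (0 + 0 ^ 3) / (L : ℝ) ^ 2 = 0 := by norm_num
  rw [e0] at hA
  exact (ne3Shape_minActReadings_iff L M).2 ⟨⟨hθ0, inv_lt_one_of_one_lt₀ hLsq⟩, hA, fun _ _ => localRate_flat L M le_rfl hθ0⟩

/-- **ROOT B FIRED THROUGH THE c7-ADAPTER END ON NE3's CARRIER, NO HYPOTHESIS LEFT** (`L ≥ 2`, `d ≥ 1`, `N ≥ 1`, `a′ > 0`, non-empty colour index):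
leaf-08-g2's `NE2BalabanFromNE3.balaban_final_rate_of_ne3Shape_sq` at the flat datum `flatCfg ∈ {flatCfg}` with `Rg := fun _ ↦ oneR`,
`hNE3 := ne3Shape_minActReadings_flat`, `hreg := regularTransporters_flat` (`α = β = 0`), `η := η⋆` (`etaStar_pos`).  The conclusion is LITERALLY
`NE2BalabanFlatWitness.balaban_final_rate_flat`'s — ROOT B's END at the flat background — now reached through node U1b's full shape on NE3's own
readings object: the DAG edge NE2(tier B) ⇐ NE3 exercised end to end by one kernel datum.  Trivial by design; NE2 NOT proved; NE3 NOT proved.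
[folklore] -/
theorem balaban_final_rate_of_ne3Shape_flat (hL : 2 ≤ L) (hd : 1 ≤ d) {N : ℕ} (hN : 1 ≤ N) {a' : ℝ} (ha' : 0 < a') :
    TowerLimitRate (fun k => Qlev L M k ⊗ₖ (1 : Matrix o o ℂ)) ((L : ℝ) ^ d)
      (fun k => (calDalev L M a ha k ⊗ₖ (1 : Matrix o o ℂ)
        + balabanPert L M a (liftR L M (oneR L M (o := o)))
            (gaugeSlot L M (oneR L M (o := o)) (QuT L M o (siteT L M (oneR L M (o := o)))) (Q1 L M o) a') k)⁻¹)
      (Cpert (kappaBs o d a 0 0 (a * (epsR o d 0 * (2 + epsR o d 0) * Cst d a)) (kappa4F d a a' 0 0))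
        (2 * d * Cst d a) (CJ d a)
        (C2Bs o d L a 0 0 0
          (a * C2gram (Cst d a) 1 (epsR o d 0) (2 * d * Cst d a) (CJ d a) (Cst d a) (CdeltaR o d a 0 (theta0 d 0 (betaNE3 o 0))))
          (C4F o d L a a' 0 0 0)) 0 1) ((L : ℝ)⁻¹) := by
  have hη := etaStar_pos (o := o) (d := d) a ha.le ha'.le
  exact balaban_final_rate_of_ne3Shape_sq L M a ha (𝒞 := flatClass) (N := N)
    (dom := {(flatCfg : B7Prop1Explicit.Site d → Fin d → (Matrix o o ℂ)ˣ)}) (Rg := fun _ => oneR L M (o := o))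
    hL hd le_rfl (ne3Shape_minActReadings_flat L M hL hN) (Set.mem_singleton _) (regularTransporters_flat L M) ha' hη.le hη.le le_rfl

/-- the two routes to ROOT B's END at the flat background AGREE: through NE3's carrier (this file) and directly (row B7.w file 1) — the same
proposition, two kernel proofs. [folklore] -/
theorem balaban_final_rate_flat_two_routes (hL : 2 ≤ L) (hd : 1 ≤ d) {N : ℕ} (hN : 1 ≤ N) {a' : ℝ} (ha' : 0 < a') :
    (balaban_final_rate_of_ne3Shape_flat L M a ha hL hd hN ha' :
      TowerLimitRate (fun k => Qlev L M k ⊗ₖ (1 : Matrix o o ℂ)) ((L : ℝ) ^ d)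
      (fun k => (calDalev L M a ha k ⊗ₖ (1 : Matrix o o ℂ)
        + balabanPert L M a (liftR L M (oneR L M (o := o)))
            (gaugeSlot L M (oneR L M (o := o)) (QuT L M o (siteT L M (oneR L M (o := o)))) (Q1 L M o) a') k)⁻¹)
      (Cpert (kappaBs o d a 0 0 (a * (epsR o d 0 * (2 + epsR o d 0) * Cst d a)) (kappa4F d a a' 0 0))
        (2 * d * Cst d a) (CJ d a)
        (C2Bs o d L a 0 0 0
          (a * C2gram (Cst d a) 1 (epsR o d 0) (2 * d * Cst d a) (CJ d a) (Cst d a) (CdeltaR o d a 0 (theta0 d 0 (betaNE3 o 0))))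
          (C4F o d L a a' 0 0 0)) 0 1) ((L : ℝ)⁻¹))
      = NE2BalabanFlatWitness.balaban_final_rate_flat L M a ha hL hd ha' := rfl

end Summit.QuantumFields.BalabanUV.T4Continuum.NE2BalabanFromNE3Flat

end
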